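import Summits.CriticalPhenomena.PercolationContinuityZ3.Theorems.PercNearOneGluingNoHeavyLowerTailKnQuestion8CoefficientwiseOffClusterGen
import HarnessLib

/-!
# The no-core-free LEAK LEMMA (L′): on {p ∉ C_x(red)} ∩ {a target is red-tied to p and blue-tied to x}, the blue cluster of x dominates the red one — prim-lf-2 gen 66

Support file (`--supports stmt-CriticalPhenomena-4575`, closed), prover `prim-lf-2` (gen 66).  No definitions, no named facts, no sorries; standard axioms.
Memo `prim-lf-2/CW-BASE-gen66.md` §7.6–7.7; companion of `…CoefficientwiseRootEdgeDomination.lean` (gen 66: (L) ⟹ (REM)) and of gen 23/55's off-cluster lemma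
(`offCluster_twoColouring_nonneg_gen`, whose cell machinery is reused here).

Setting: finite multigraph `ends : ι → Sym2 V`, root `x`, a second vertex `p`, a vertex set `W` (targets), colourings `s : Finset ι` (red) / `sᶜ` (blue), `C_v(s) = openCluster (ends '' s) v`,
`K = C_x(s)` (red cluster of `x`), `B = C_x(sᶜ)` (blue cluster of `x`), `P = C_p(s)` (red cluster of `p`).
The LEAK LEMMA (L) of gen 66 (conjectured; it implies the root-edge domination (REM), `rem_nonneg_of_leak`) says: on `{p ∉ K} ∩ {W ∩ K ∩ B = ∅} ∩ {∃ w ∈ W, w ∈ P ∩ B}` the blue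
cluster dominates, `Σ (g(B) − g(K)) ≥ 0`.  THIS FILE PROVES ITS NO-CORE-FREE VARIANT (L′) — the same statement WITHOUT the condition `W ∩ K ∩ B = ∅`:
* `Coefficientwise.leak_blue_dominates_red` — **THEOREM (L′)**: for all monotone `g`,
  `0 ≤ Σ_{s : p ∉ C_x(s), ∃ w ∈ W, w ∈ C_p(s) ∧ w ∈ C_x(sᶜ)} (g(C_x(sᶜ)) − g(C_x(s)))`.
* `Coefficientwise.leak_blue_dominates_red_sub` — the same on the colourings of a sub-edge-set `E'` (blue = `E' ∖ t`).
Proof (memo §7.6): freeze the red cluster `S₀ = C_p(s)` of `p` together with the red edges inside it (the cells `{t | t ∩ I(S₀) = π}` of the off-cluster lemma): on a cell, `x ∉ S₀`,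
`C_x(t)` uses no edge at `S₀` and is dominated by the flipped configuration (`offcluster`), and the leak event `{∃ w ∈ W ∩ S₀, w ∈ C_x(tᶜ)}` is a fixed DECREASING event of the cell;
gen 25's cell inequality `twoColouring_cell_nonneg_of_le₂` with the second pair `(G, G') = (0, 1[leak])` is exactly the claim on the cell.  So (L′) is 'Harris twice after conditioning
on C_p'; what the full leak lemma (L) adds is the no-core side condition on `x`'s own clusters, which is not monotone on the cell — the open part.
[cite: KozmaNitzan2024, Questions 8–9 (§5.5 p. 36) (context: the Question-8 pocket covariance programme)]
-/

namespace Summit.CriticalPhenomena.PercolationContinuityZ3.Theorems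

open Finset Literature.Probability.Percolation

namespace Coefficientwise

variable {ι V : Type*} [Fintype ι] [DecidableEq ι]

open Classical in
/-- **THEOREM (L′) — the no-core-free leak lemma.**  For vertices `x, p`, a vertex set `W` and a monotone `g`:
`0 ≤ Σ_{s : p ∉ C_x(s), ∃ w ∈ W, w ∈ C_p(s) ∧ w ∈ C_x(sᶜ)} (g(C_x(sᶜ)) − g(C_x(s)))` — among the colourings in which `p` is not red-joined to `x` but some target is red-joined to `p`
and blue-joined to `x`, the blue cluster of `x` stochastically dominates the red one.  [cite: KozmaNitzan2024, Questions 8–9 (§5.5 p. 36) (context)] -/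
theorem leak_blue_dominates_red (ends : ι → Sym2 V) (x p : V) (W : Set V) (g : Set V → ℝ) (hg : Monotone g) :
    0 ≤ ∑ s ∈ univ.filter (fun s : Finset ι => p ∉ openCluster (ends '' (↑s : Set ι)) x ∧
          ∃ w ∈ W, w ∈ openCluster (ends '' (↑s : Set ι)) p ∧ w ∈ openCluster (ends '' (↑(sᶜ) : Set ι)) x),
      (g (openCluster (ends '' (↑(sᶜ) : Set ι)) x) - g (openCluster (ends '' (↑s : Set ι)) x)) := by
  -- notation
  set K : Finset ι → Set V := fun s => openCluster (ends '' (↑s : Set ι)) x with hK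
  set R : Finset ι → Set V := fun s => openCluster (ends '' (↑s : Set ι)) p with hR
  set F : Finset ι → ℝ := fun s => g (K s) with hF
  set D : Finset (Finset ι) := univ.filter (fun s : Finset ι => p ∉ K s) with hD
  have hKmono : ∀ {s t : Finset ι}, s ⊆ t → K s ⊆ K t := fun hst => openCluster_image_mono ends hst x
  have hFm : Monotone F := fun s t hst => hg (hKmono hst)
  -- rewrite the sum over the leak event as a sum over `D` of an indicator-weighted summand
  have hsplit : (univ.filter (fun s : Finset ι => p ∉ K s ∧ ∃ w ∈ W, w ∈ R s ∧ w ∈ K sᶜ)) =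
      D.filter (fun s : Finset ι => ∃ w ∈ W, w ∈ R s ∧ w ∈ K sᶜ) := by
    rw [hD, Finset.filter_filter]
  change 0 ≤ ∑ s ∈ univ.filter (fun s : Finset ι => p ∉ K s ∧ ∃ w ∈ W, w ∈ R s ∧ w ∈ K sᶜ), (F sᶜ - F s)
  rw [hsplit, Finset.sum_filter]
  -- the edges at a vertex set, and the cell key
  set I : Set V → Finset ι := fun S => univ.filter (fun i : ι => ∃ v ∈ S, v ∈ ends i) with hI
  set key : Finset ι → Set V × Finset ι := fun s => (R s, s ∩ I (R s)) with hkey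
  have R_closed : ∀ (s : Finset ι) {u w : V}, u ∈ R s → (openGraph (ends '' (↑s : Set ι))).Adj u w → w ∈ R s :=
    fun s u w hu hadj => SimpleGraph.Reachable.trans hu hadj.reachable
  have mem_I : ∀ (S : Set V) (i : ι) (v : V), v ∈ S → v ∈ ends i → i ∈ I S := by
    intro S i v hv hvi
    simp only [hI, Finset.mem_filter, Finset.mem_univ, true_and]
    exact ⟨v, hv, hvi⟩
  have p_mem_R : ∀ s : Finset ι, p ∈ R s := fun s => mem_openCluster_self _ p
  -- locality: a configuration agreeing with `s₀` on the edges at `R s₀` has the same red cluster of `p`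
  have locality : ∀ s₀ t : Finset ι, t ∩ I (R s₀) = s₀ ∩ I (R s₀) → R t = R s₀ := by
    intro s₀ t ht
    have agree : ∀ i, i ∈ I (R s₀) → (i ∈ t ↔ i ∈ s₀) := by
      intro i hi
      have := congrArg (fun u : Finset ι => i ∈ u) ht
      simp only [Finset.mem_inter, hi, and_true, eq_iff_iff] at this
      exact this
    have h1 : ∀ u ∈ R s₀, ∀ w, (openGraph (ends '' (↑s₀ : Set ι))).Adj u w →
        (openGraph (ends '' (↑t : Set ι))).Adj u w ∧ w ∈ R s₀ := by
      intro u hu w hadj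
      refine ⟨?_, R_closed s₀ hu hadj⟩
      rw [openGraph_image_adj] at hadj ⊢
      obtain ⟨⟨i, his, hi⟩, hne⟩ := hadj
      have hiI : i ∈ I (R s₀) := mem_I _ i u hu (by rw [hi]; exact Sym2.mem_mk_left u w)
      exact ⟨⟨i, (agree i hiI).mpr his, hi⟩, hne⟩
    have h2 : ∀ u ∈ R s₀, ∀ w, (openGraph (ends '' (↑t : Set ι))).Adj u w →
        (openGraph (ends '' (↑s₀ : Set ι))).Adj u w ∧ w ∈ R s₀ := by
      intro u hu w hadj
      have hadj' : (openGraph (ends '' (↑s₀ : Set ι))).Adj u w := by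
        rw [openGraph_image_adj] at hadj ⊢
        obtain ⟨⟨i, hit, hi⟩, hne⟩ := hadj
        have hiI : i ∈ I (R s₀) := mem_I _ i u hu (by rw [hi]; exact Sym2.mem_mk_left u w)
        exact ⟨⟨i, (agree i hiI).mp hit, hi⟩, hne⟩
      exact ⟨hadj', R_closed s₀ hu hadj'⟩
    ext y
    constructor
    · intro hy
      obtain ⟨q⟩ := hy
      exact ((reachable_transfer (R s₀) h2 q) (p_mem_R s₀)).2
    · intro hy
      obtain ⟨q⟩ := hy
      exact ((reachable_transfer (R s₀) h1 q) (p_mem_R s₀)).1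
  -- split the sum over `D` along the fibres of `key`
  rw [← Finset.sum_fiberwise_of_maps_to (s := D) (t := D.image key) (g := key)
    (fun s hs => Finset.mem_image_of_mem key hs)]
  refine Finset.sum_nonneg fun k hk => ?_
  obtain ⟨s₀, hs₀D, rfl⟩ := Finset.mem_image.mp hk
  have hs₀ : p ∉ K s₀ := (Finset.mem_filter.mp hs₀D).2
  -- frozen data of the cell of `s₀`
  set S₀ : Set V := R s₀ with hS₀
  set B : Finset ι := I S₀ with hB
  set π : Finset ι := s₀ ∩ B with hπ
  have hxS₀ : x ∉ S₀ := fun hx => hs₀ (SimpleGraph.Reachable.symm hx)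
  -- the fibre of `key s₀` in `D` is the cell `{t | t ∩ B = π}`
  have fiber_eq : D.filter (fun t => key t = key s₀) = univ.filter (fun t : Finset ι => t ∩ B = π) := by
    ext t
    simp only [Finset.mem_filter, Finset.mem_univ, true_and]
    constructor
    · rintro ⟨_, hkt⟩
      have h1 : R t = S₀ := (Prod.ext_iff.mp hkt).1
      have h2 : t ∩ I (R t) = s₀ ∩ I (R s₀) := (Prod.ext_iff.mp hkt).2
      rw [h1] at h2
      exact h2
    · intro ht
      have hRt : R t = S₀ := locality s₀ t ht
      refine ⟨?_, ?_⟩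
      · rw [hD, Finset.mem_filter]
        refine ⟨Finset.mem_univ _, fun hpt => ?_⟩
        have hxRt : x ∈ R t := SimpleGraph.Reachable.symm hpt
        rw [hRt] at hxRt
        exact hxS₀ hxRt
      · change (R t, t ∩ I (R t)) = (R s₀, s₀ ∩ I (R s₀))
        rw [hRt]
        exact Prod.ext rfl ht
  rw [fiber_eq]
  -- on the cell, the red cluster of `x` uses no edge at `S₀`, so it is dominated by the flipped configuration
  have offcluster : ∀ t : Finset ι, t ∩ B = π → K t ⊆ K ((B \ π) ∪ (t \ B)) := by
    intro t ht
    have agree : ∀ i, i ∈ B → (i ∈ t ↔ i ∈ s₀) := by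
      intro i hi
      have := congrArg (fun u : Finset ι => i ∈ u) ht
      simp only [hπ, Finset.mem_inter, hi, and_true, eq_iff_iff] at this
      exact this
    have htr : ∀ u ∈ S₀ᶜ, ∀ w, (openGraph (ends '' (↑t : Set ι))).Adj u w →
        (openGraph (ends '' (↑(t \ B) : Set ι))).Adj u w ∧ w ∈ S₀ᶜ := by
      intro u hu w hadj
      rw [openGraph_image_adj] at hadj
      obtain ⟨⟨i, hit, hi⟩, hne⟩ := hadj
      have hiB : i ∉ B := by
        intro hiB
        have his₀ : i ∈ s₀ := (agree i hiB).mp hit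
        have hiB' := hiB
        simp only [hB, hI, Finset.mem_filter, Finset.mem_univ, true_and] at hiB'
        obtain ⟨v, hvS, hvi⟩ := hiB'
        rw [hi, Sym2.mem_iff] at hvi
        rcases hvi with rfl | rfl
        · exact hu hvS
        · have hadj₀ : (openGraph (ends '' (↑s₀ : Set ι))).Adj v u := by
            rw [openGraph_image_adj]
            exact ⟨⟨i, his₀, by rw [hi, Sym2.eq_swap]⟩, hne.symm⟩
          exact hu (R_closed s₀ hvS hadj₀)
      have hwS : w ∈ S₀ᶜ := by
        intro hwS
        exact hiB (mem_I S₀ i w hwS (by rw [hi]; exact Sym2.mem_mk_right u w))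
      refine ⟨?_, hwS⟩
      rw [openGraph_image_adj]
      exact ⟨⟨i, Finset.mem_sdiff.mpr ⟨hit, hiB⟩, hi⟩, hne⟩
    intro y hy
    obtain ⟨q⟩ := hy
    have hreach := ((reachable_transfer S₀ᶜ htr q) hxS₀).1
    exact hKmono Finset.subset_union_right hreach
  -- the leak event is a fixed decreasing event of the cell: its indicator on the blue side
  set G' : Finset ι → ℝ := fun u => if (∃ w ∈ W, w ∈ S₀ ∧ w ∈ K u) then 1 else 0 with hG'
  have hG'm : Monotone G' := by
    intro u v huv
    simp only [hG']
    by_cases h : ∃ w ∈ W, w ∈ S₀ ∧ w ∈ K u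
    · have h' : ∃ w ∈ W, w ∈ S₀ ∧ w ∈ K v := by
        obtain ⟨w, hwW, hwS, hwK⟩ := h
        exact ⟨w, hwW, hwS, hKmono huv hwK⟩
      rw [if_pos h, if_pos h']
    · rw [if_neg h]
      split_ifs <;> norm_num
  have hG'0 : ∀ u, (fun _ : Finset ι => (0 : ℝ)) u ≤ G' u := by
    intro u; simp only [hG']; split_ifs <;> norm_num
  have cell := twoColouring_cell_nonneg_of_le₂ B π Finset.inter_subset_right F F (fun _ => (0 : ℝ)) G' hFm hFm
    (fun _ _ _ => le_refl _) hG'm (fun t => le_refl _) hG'0 (fun t ht => hg (offcluster t ht)) (fun t _ => le_refl _)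
  -- identify the cell sum with ours
  refine cell.trans_eq (Finset.sum_congr rfl fun t ht => ?_)
  have htcell : t ∩ B = π := (Finset.mem_filter.mp ht).2
  have hRt : R t = S₀ := by
    apply locality s₀ t
    rw [← hB, htcell, hπ]
  have hiff : (∃ w ∈ W, w ∈ R t ∧ w ∈ K tᶜ) ↔ (∃ w ∈ W, w ∈ S₀ ∧ w ∈ K tᶜ) := by rw [hRt]
  by_cases hleak : ∃ w ∈ W, w ∈ R t ∧ w ∈ K tᶜ
  · rw [if_pos hleak]
    simp only [hG', if_pos (hiff.mp hleak)]
    ring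
  · rw [if_neg hleak]
    simp only [hG', if_neg (fun h => hleak (hiff.mpr h))]
    ring

section sub

omit [Fintype ι] [DecidableEq ι] in
open Classical in
/-- Clusters of a colouring of the sub-multigraph on `{i // i ∈ E'}` are the clusters of its image colouring. [cite: KozmaNitzan2024, §5.5 (context only; bookkeeping)] -/
private theorem image_map_subtype_leak (ends : ι → Sym2 V) (E' : Finset ι) (t : Finset {i // i ∈ E'}) :
    (ends ∘ Subtype.val : {i // i ∈ E'} → Sym2 V) '' (↑t : Set {i // i ∈ E'}) =
      ends '' (↑(t.map (Function.Embedding.subtype _)) : Set ι) := by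
  ext q
  simp only [Set.mem_image, Finset.mem_coe, Finset.mem_map, Function.Embedding.coe_subtype, Function.comp_apply]
  constructor
  · rintro ⟨j, hj, rfl⟩; exact ⟨j.1, ⟨j, hj, rfl⟩, rfl⟩
  · rintro ⟨i, ⟨j, hj, rfl⟩, rfl⟩; exact ⟨j, hj, rfl⟩

omit [Fintype ι] in
open Classical in
/-- **Powerset form of (L′).**  For an edge set `E'`, root `x`, vertex `p`, targets `W` and monotone `g`:
`0 ≤ Σ_{t ⊆ E' : p ∉ C_x(t), ∃ w ∈ W, w ∈ C_p(t) ∧ w ∈ C_x(E'∖t)} (g(C_x(E'∖t)) − g(C_x(t)))`.  This is the hypothesis (L) of `rem_nonneg_of_leak` WITHOUT its no-core condition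
`∀ w ∈ W, ¬(w ∈ C_x t ∧ w ∈ C_x(E'∖t))`.  [cite: KozmaNitzan2024, Questions 8–9 (§5.5 p. 36) (context)] -/
theorem leak_blue_dominates_red_sub (ends : ι → Sym2 V) (E' : Finset ι) (x p : V) (W : Set V) (g : Set V → ℝ) (hg : Monotone g) :
    0 ≤ ∑ t ∈ E'.powerset.filter (fun t : Finset ι => p ∉ openCluster (ends '' (↑t : Set ι)) x ∧
          ∃ w ∈ W, w ∈ openCluster (ends '' (↑t : Set ι)) p ∧ w ∈ openCluster (ends '' (↑(E' \ t) : Set ι)) x),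
      (g (openCluster (ends '' (↑(E' \ t) : Set ι)) x) - g (openCluster (ends '' (↑t : Set ι)) x)) := by
  set emb : {i // i ∈ E'} ↪ ι := Function.Embedding.subtype _ with hemb
  have map_sub : ∀ t : Finset {i // i ∈ E'}, t.map emb ⊆ E' := by
    intro t i hi
    obtain ⟨⟨j, hj⟩, _, rfl⟩ := Finset.mem_map.mp hi
    exact hj
  have key := leak_blue_dominates_red (ends ∘ Subtype.val : {i // i ∈ E'} → Sym2 V) x p W g hg
  have map_compl : ∀ t : Finset {i // i ∈ E'}, (tᶜ).map emb = E' \ t.map emb := by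
    intro t
    ext i
    simp only [Finset.mem_map, Finset.mem_compl, Finset.mem_sdiff, hemb, Function.Embedding.coe_subtype]
    constructor
    · rintro ⟨⟨j, hj⟩, hjt, rfl⟩
      exact ⟨hj, fun ⟨⟨k, hk⟩, hkt, hkj⟩ => hjt (by cases hkj; exact hkt)⟩
    · rintro ⟨hiE, hnot⟩
      exact ⟨⟨i, hiE⟩, fun hit => hnot ⟨⟨i, hiE⟩, hit, rfl⟩, rfl⟩
  refine key.trans_eq ?_
  refine Finset.sum_bij' (fun t _ => t.map emb) (fun t _ => t.subtype (· ∈ E')) ?_ ?_ ?_ ?_ ?_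
  · intro t ht
    rw [Finset.mem_filter] at ht ⊢
    refine ⟨Finset.mem_powerset.mpr (map_sub t), ?_⟩
    rw [← image_map_subtype_leak ends E' t, ← map_compl, ← image_map_subtype_leak ends E' tᶜ]; exact ht.2
  · intro t ht
    rw [Finset.mem_filter] at ht ⊢
    refine ⟨Finset.mem_univ _, ?_⟩
    have hsub : t ⊆ E' := Finset.mem_powerset.mp ht.1
    have h1 : (t.subtype (· ∈ E')).map emb = t := Finset.subtype_map_of_mem (fun i hi => hsub hi)
    rw [image_map_subtype_leak ends E', image_map_subtype_leak ends E', map_compl, h1]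
    exact ht.2
  · intro t _
    ext ⟨i, hi⟩
    rw [Finset.mem_subtype, Finset.mem_map]
    constructor
    · rintro ⟨⟨j, hj⟩, hjt, hji⟩
      have hji' : j = i := by simpa [hemb] using hji
      subst hji'
      exact hjt
    · intro h
      exact ⟨⟨i, hi⟩, h, by simp [hemb]⟩
  · intro t ht
    have hsub : t ⊆ E' := Finset.mem_powerset.mp (Finset.mem_filter.mp ht).1
    exact Finset.subtype_map_of_mem (fun i hi => hsub hi)
  · intro t _
    rw [image_map_subtype_leak ends E' t, ← map_compl, image_map_subtype_leak ends E' tᶜ]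

end sub

end Coefficientwise

end Summit.CriticalPhenomena.PercolationContinuityZ3.Theorems
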